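import Summits.BirchSwinnertonDyer.Rank1Residual.X11b.BDPRouteSurj
import Summits.BirchSwinnertonDyer.Rank1Residual.X11b.BDPRouteOddPrimeClass
import HarnessLib

/-!
# Class X11b, route "BDP + converse-theorem engine + Kolyvagin": the main-conjecture half on X11b ∧ surj(p) from STEP L at EVERY ODD PRIME (p = 3 included), no (ram) prime (cell `b2b-bsdres`, sub-cell `multr1-p2`, gen 6)

HONEST FRAMING (cell `b2b-bsdres`, run/shared/lean/b2b/bsd-rank1-residual/, verbatim in every
file): the goal of the cell is to DELETE the COMBINATION-SHAPED residual classes of the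
Birch–Swinnerton-Dyer formula for ALL analytic-rank `≤ 1` elliptic curves over `ℚ` — "full BSD
formula for every rank `≤ 1` curve in class `C`" assembled STRICTLY from published theorems — so
that the rank-`≤ 1` remainder becomes exactly the CONSTRUCTION-SHAPED classes, which are TYPED
(missing-input `Prop`s), NOT attempted. This is not "finishing BSD". Sub-cell `multr1-p2` is a
RESEARCH ROUTE on class X11b (`ClassX11b W p := r_an = 1 ∧ p ≠ 2 ∧ mult(p) ∧ irr(p)`,
`Partition/Rows.lean`); no claim beyond the stated class and loci; X11b's label and X11 (p = 3)'s
label do not change; nothing is booked.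

THEOREMS ONLY (no definition, no named fact). `X11b/BDPRouteSurj.lean` (gen 6) proved, for `p ≥ 5`:
on X11b ∧ surj(p) the route's typed input STEP L gives the main-conjecture half
`Typed.MissingLowerBoundAt W p`, the twist's `≤`-half coming from Wuthrich, Doc. Math. 19 (2014)
Prop. 21 (tree fact `Wuthrich2014.sha_dvd_analyticSha`: ODD `p`, not additive, `ρ̄` surjective or
Borel) instead of Skinner 2016 Thm. C (which needs (ram)). The only `p ≥ 5` ingredient there was the
Friedberg–Hoffstein field with transport (d) `ord_p ∏c(E^{d_K}) = ord_p ∏c(E)` for ANY Heegner `K`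
(`padicValNat_tamagawaProduct_twist_of_heegner`, `p ≥ 5`). Exactly as in gen 4
(`X11b/BDPRouteOddPrime{,Class}.lean`), at an arbitrary odd `p` one uses instead a Hoffstein–Luo field
with `d_K` ODD and `p ∤ d_K` (`exists_oddHeegnerData`: x1a's admissible-field supply + Mazur 1978
Cor. 4.1 + Néron) and eisenstein-p2's transport (d) for odd `d_K`
(`X2.padicValNat_tamagawaProduct_twist_of_heegner_of_odd`). So:

* `missingLowerBoundAt_of_indexLowerBoundAt_of_surj_odd` — data level, `p` odd, `d_K` odd, `p ∤ d_K`;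
* **`missingLowerBoundAt_of_classX11b_of_surj_odd`** — ∀ `(E,p)` ∈ X11b (any odd `p`, `p = 3`
  included) with `ρ̄_{E,p}` onto: STEP L at the odd-`d_K` Manin-good Heegner data ⇒
  `Typed.MissingLowerBoundAt W p`; PUBLISHED binders `hGZ`, `hKo`, `hWu` (Wuthrich Prop. 21), `hGZK`,
  `hmod`, `hnf`, `hHL` (Hoffstein–Luo), `hMaz`, `hNS`;
* `IsX11Three.missingLowerBoundAt_of_surj_of_indexLowerBoundAt_oddData` — the same read in the
  cell's `IsX11Three` vocabulary (X11 ∧ `p = 3` ∧ `r = 1`).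

READING: at `p = 3` the in-window X11b rows are all booked per pair (T-SEL3, 628 ‖ 214); this is
class-level bookkeeping: on X11b ∧ surj(3) — (ram) or not — the lower half of `BSD(E,3)` is exactly
what STEP L delivers; STEP L at `p = 3` has no source, even announced (gen 5 §11.3). Compare gen 4's
`missingLowerBoundAt_of_classX11b_of_ram_odd` ((ram), Skinner Thm. C). CONDITIONAL on STEP L.

References: [Wuthrich2014] Prop. 21 (p. 400); [JetchevSkinnerWan2017] §7.4.1 (pp. 30–31 of
arXiv:1512.06894); [HoffsteinLuo1997]; [Mazur1978] Cor. 4.1; [Miller2011LMS] Def. 1.1.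
-/

noncomputable section

open scoped Classical

open WeierstrassCurve NumberField Literature.NumberTheory.EllipticCurves
  Literature.NumberTheory.EllipticCurves.ModularForms
  Literature.NumberTheory.EllipticCurves.Rank1Residual
  Literature.NumberTheory.EllipticCurves.Rank1Residual.Typed
  Literature.NumberTheory.EllipticCurves.Wuthrich2014

namespace Summit.BirchSwinnertonDyer.Rank1Residual.X11b

/-- **STEP L ⇒ the main-conjecture half at fixed odd-`d_K` Heegner data, `p` odd, `ρ̄_{E,p}` onto (no
(ram) prime).** As `missingLowerBoundAt_of_indexLowerBoundAt_of_surj` with `5 ≤ p` replaced by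
`p ≠ 2`, `d_K` odd and `p ∤ d_K` (transport (d) at odd `p` is eisenstein-p2's
`X2.padicValNat_tamagawaProduct_twist_of_heegner_of_odd`). PUBLISHED binders `hGZ`, `hKo`, `hWu`
(Wuthrich 2014 Prop. 21, for the twist: multiplicative at `p`, `ρ̄_{E^D,p}` onto), `hGZK`, `hmod`.
CONDITIONAL on STEP L (`hL`). [cite: Wuthrich2014, Prop. 21 (p. 400)]
[cite: JetchevSkinnerWan2017, §7.4.1 (pp. 30–31)] [cite: Miller2011LMS, Def. 1.1] -/
theorem missingLowerBoundAt_of_indexLowerBoundAt_of_surj_odd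
    (W : WeierstrassCurve ℚ) [W.IsElliptic] [W.IsGloballyMinimal] (p : ℕ) [Fact p.Prime]
    [NeZero (W.conductorNorm ℤ)] (K : Type) [Field K] [NumberField K]
    (Dt : ModularParametrizationData W (W.conductorNorm ℤ))
    (H : HeegnerDatum (W.conductorNorm ℤ) (NumberField.discr K)) (ι : K →+* ℂ)
    (P : (W.baseChange K).toAffine.Point)
    -- the published inputs (named facts of the tree)
    (hGZ : gross_zagier (W.conductorNorm ℤ) W K) (hKo : kolyvagin (W.conductorNorm ℤ) W K)
    (hWu : sha_dvd_analyticSha)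
    (hGZK : rank_eq_analyticRank_of_analyticRank_le_one) (hmod : hasEntireLFunction_rat)
    -- the pair
    (hr : W.analyticRank = 1) (hp2 : p ≠ 2) (hmult : Mult W p) (hsurj : Surj W p)
    -- the Heegner data (`d_K` odd, `p ∤ d_K`)
    (hK : IsImaginaryQuadratic K) (hodd : Odd (NumberField.discr K))
    (hpd : ¬ (p : ℤ) ∣ NumberField.discr K)
    (hHN : SatisfiesHeegnerHypothesis (W.conductorNorm ℤ) K)
    (hP : WeierstrassCurve.Affine.Point.map ι.toRatAlgHom P = heegnerPointComplex Dt H)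
    (hc : ¬ (p : ℤ) ∣ Dt.c) (hμ : ¬ p ∣ Units.torsionOrder K)
    (hLt : (W.quadraticTwist (NumberField.discr K : ℚ)).entireLFunction 1 ≠ 0)
    (Wd : WeierstrassCurve ℚ) [Wd.IsElliptic] [Wd.IsGloballyMinimal] (Cd : VariableChange ℚ)
    (hWd : Cd • W.quadraticTwist (NumberField.discr K : ℚ) = Wd)
    -- STEP L (the typed input of the route)
    (hL : IndexLowerBoundAt W p K P) :
    Typed.MissingLowerBoundAt W p := by
  have hD0 : (NumberField.discr K : ℚ) ≠ 0 := by exact_mod_cast NumberField.discr_ne_zero K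
  haveI hEt : (W.quadraticTwist (NumberField.discr K : ℚ)).IsElliptic :=
    W.isElliptic_quadraticTwist hD0
  -- transports (a), (d) [odd `d_K`], (e) and surjectivity to the minimal twist model
  have hmultd : Wd.HasMultiplicativeReductionAtPrime p :=
    hasMultiplicativeReductionAtPrime_twist_of_heegner' W p K hK hHN hmult Cd hWd
  have hsurjd : Surj Wd p := surj_twist_model W p K hsurj Cd hWd
  have htam : padicValNat p Wd.tamagawaProduct = padicValNat p W.tamagawaProduct :=
    X2.padicValNat_tamagawaProduct_twist_of_heegner_of_odd W p hp2 K hK hodd hpd hHN Cd hWd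
  have hu : padicValRat p (Cd.u : ℚ) = 0 :=
    padicValRat_u_eq_zero_of_twist_minimal W p K hK hHN hmult Cd hWd
  -- the twist: `L(E^D,1) ≠ 0` and Wuthrich's `≤`-half
  have hLt' : (W.quadraticTwist (NumberField.discr K : ℚ)).entireLFunction = Wd.entireLFunction := by
    rw [← hWd, entireLFunction_smul]
  have hLd1 : Wd.entireLFunction 1 ≠ 0 := by rw [← hLt']; exact hLt
  have htw := twist_le_half_of_wuthrich hWu hGZK hmod Wd p hp2 hLd1 hmultd hsurjd
  exact missingLowerBoundAt_of_indexLowerBoundAt W p (W.conductorNorm ℤ) K Dt H ι P hGZ hKo hGZK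
    hmod hK hHN hP hp2 hc hμ hr hLt Wd Cd hWd hu htam htw (fun _ ↦ hL)

/-- **The main-conjecture half of `BSD(E,p)` from STEP L on X11b ∧ surj(p) — EVERY ODD PRIME, no
(ram) prime, no Tamagawa condition.** For every `(E,p)` in X11b (any odd `p`, `p = 3` included) with
`ρ̄_{E,p}` onto `GL₂(𝔽_p)`: STEP L (`hL`, the route's typed input, OPEN at `p ∥ N`) at the odd-`d_K`
Manin-good Heegner data of such pairs, with the PUBLISHED named facts `hGZ`, `hKo`, `hWu` (Wuthrich
2014 Prop. 21), `hGZK`, `hmod`, `hnf`, `hHL` (Hoffstein–Luo: `K` with `d_K ≡ 1 (mod 8)`, `d_K < −4`,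
every `ℓ ∣ N·p` split, `L(E^{d_K},1) ≠ 0`), `hMaz`, `hNS` (`exists_oddHeegnerData`), gives
`ord_p #Ш(E)_an ≤ ord_p #Ш(E)`. Extends gen 4's `missingLowerBoundAt_of_classX11b_of_ram_odd` from
(ram) to surj ((ram) ⇒ surj, `surj_of_irr_of_ram`) and gen 6's
`missingLowerBoundAt_of_classX11b_of_surj` from `p ≥ 5` to every odd `p`. CONDITIONAL on STEP L;
nothing booked. [cite: Wuthrich2014, Prop. 21 (p. 400)] [cite: JetchevSkinnerWan2017, §7.4.1 (pp. 30–31)]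
[cite: Mazur1978, Cor. 4.1] [cite: Miller2011LMS, Def. 1.1] -/
theorem missingLowerBoundAt_of_classX11b_of_surj_odd
    -- published inputs (named facts of the tree)
    (hGZ : ∀ (N : ℕ) [NeZero N] (W : WeierstrassCurve ℚ) (K : Type) [Field K] [NumberField K],
      gross_zagier N W K)
    (hKo : ∀ (N : ℕ) [NeZero N] (W : WeierstrassCurve ℚ) (K : Type) [Field K] [NumberField K],
      kolyvagin N W K)
    (hWu : sha_dvd_analyticSha)
    (hGZK : rank_eq_analyticRank_of_analyticRank_le_one) (hmod : hasEntireLFunction_rat)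
    (hnf : exists_isNewformOf) (hHL : HoffsteinLuo1997_exists_twist_L_one_ne_zero)
    (hMaz : mazur_not_dvd_maninConstant_of_odd) (hNS : integral_neronScaling_of_isGloballyMinimal)
    -- the typed input of the route (STEP L), at the odd-`d_K` Heegner data of surjective X11b pairs
    (hL : ∀ (W : WeierstrassCurve ℚ) [W.IsElliptic] [W.IsGloballyMinimal] (p : ℕ) [Fact p.Prime]
      (N : ℕ) [NeZero N] (K : Type) [Field K] [NumberField K]
      (Dt : ModularParametrizationData W N) (H : HeegnerDatum N (NumberField.discr K)) (ι : K →+* ℂ)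
      (P : (W.baseChange K).toAffine.Point),
      ClassX11b W p → Surj W p → W.conductorNorm ℤ = N → IsImaginaryQuadratic K →
      Odd (NumberField.discr K) → ¬ (p : ℤ) ∣ NumberField.discr K → ¬ p ∣ Units.torsionOrder K →
      SatisfiesHeegnerHypothesis N K →
      (W.quadraticTwist (NumberField.discr K : ℚ)).entireLFunction 1 ≠ 0 →
      WeierstrassCurve.Affine.Point.map ι.toRatAlgHom P = heegnerPointComplex Dt H →
      ¬ (p : ℤ) ∣ Dt.c → IndexLowerBoundAt W p K P) :
    ∀ (W : WeierstrassCurve ℚ) [W.IsElliptic] [W.IsGloballyMinimal] (p : ℕ) [Fact p.Prime],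
      ClassX11b W p → Surj W p → Typed.MissingLowerBoundAt W p := by
  intro W _ _ p _ hX hsurj
  have hX' := hX
  obtain ⟨hr, hp2, hmult, hirr⟩ := hX
  haveI : NeZero (W.conductorNorm ℤ) := ⟨(W.conductorNorm_pos_holds).ne'⟩
  obtain ⟨K, _, _, Dt, H, ι, P, Wd, _, _, Cd, hK, hodd, hpd, hHN, hP, hc, hμ, hLt, hWd⟩ :=
    exists_oddHeegnerData hnf hHL hMaz hNS W p hr hp2 hmult hirr
  exact missingLowerBoundAt_of_indexLowerBoundAt_of_surj_odd W p K Dt H ι P (hGZ _ W K) (hKo _ W K)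
    hWu hGZK hmod hr hp2 hmult hsurj hK hodd hpd hHN hP hc hμ hLt Wd Cd hWd
    (hL W p _ K Dt H ι P hX' hsurj rfl hK hodd hpd hμ hHN hLt hP hc)

/-- **X11 ∧ `p = 3` ∧ `r = 1` (`IsX11Three`), surj(3): the main-conjecture half of `BSD(E,3)` ⇐
STEP L at `3`** — `missingLowerBoundAt_of_classX11b_of_surj_odd` read through the cell's `IsX11Three`
vocabulary (`classX11b_three_of_isX11Three`). (ram) is NOT required (gen 4's
`IsX11Three.bsdp_of_ram_of_not_dvd_of_indexLowerBoundAt` needed it for BOTH halves); the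
Euler-system half without (ram) is the business of `X11b/BDPRouteNoRam.lean` (`p ≥ 5` there).
CONDITIONAL on STEP L, which at `p = 3` has no source even announced. Nothing booked.
[cite: Wuthrich2014, Prop. 21 (p. 400)] [cite: Miller2011LMS, Def. 1.1] -/
theorem IsX11Three.missingLowerBoundAt_of_surj_of_indexLowerBoundAt_oddData
    (hGZ : ∀ (N : ℕ) [NeZero N] (W : WeierstrassCurve ℚ) (K : Type) [Field K] [NumberField K],
      gross_zagier N W K)
    (hKo : ∀ (N : ℕ) [NeZero N] (W : WeierstrassCurve ℚ) (K : Type) [Field K] [NumberField K],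
      kolyvagin N W K)
    (hWu : sha_dvd_analyticSha)
    (hGZK : rank_eq_analyticRank_of_analyticRank_le_one) (hmod : hasEntireLFunction_rat)
    (hnf : exists_isNewformOf) (hHL : HoffsteinLuo1997_exists_twist_L_one_ne_zero)
    (hMaz : mazur_not_dvd_maninConstant_of_odd) (hNS : integral_neronScaling_of_isGloballyMinimal)
    (hL : ∀ (W : WeierstrassCurve ℚ) [W.IsElliptic] [W.IsGloballyMinimal] (p : ℕ) [Fact p.Prime]
      (N : ℕ) [NeZero N] (K : Type) [Field K] [NumberField K]
      (Dt : ModularParametrizationData W N) (H : HeegnerDatum N (NumberField.discr K)) (ι : K →+* ℂ)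
      (P : (W.baseChange K).toAffine.Point),
      ClassX11b W p → Surj W p → W.conductorNorm ℤ = N → IsImaginaryQuadratic K →
      Odd (NumberField.discr K) → ¬ (p : ℤ) ∣ NumberField.discr K → ¬ p ∣ Units.torsionOrder K →
      SatisfiesHeegnerHypothesis N K →
      (W.quadraticTwist (NumberField.discr K : ℚ)).entireLFunction 1 ≠ 0 →
      WeierstrassCurve.Affine.Point.map ι.toRatAlgHom P = heegnerPointComplex Dt H →
      ¬ (p : ℤ) ∣ Dt.c → IndexLowerBoundAt W p K P)
    (W : WeierstrassCurve ℚ) [W.IsElliptic] [W.IsGloballyMinimal] (h3 : IsX11Three W)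
    (hsurj : Surj W 3) : Typed.MissingLowerBoundAt W 3 :=
  missingLowerBoundAt_of_classX11b_of_surj_odd hGZ hKo hWu hGZK hmod hnf hHL hMaz hNS hL W 3
    (classX11b_three_of_isX11Three W h3) hsurj

end Summit.BirchSwinnertonDyer.Rank1Residual.X11b

end
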